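import Mathlib
import HarnessLib
import Summits.Langlands.Langlands.Theses.OccultE6Transport

/-!
# Birth skeleton (BC3) for crux stmt-Langlands-14222
`Summit.Langlands.Langlands.Theses.OccultE6Transport.E6ResidualTransport` — line `birth`

Route `route-Langlands-OccultE6Transport` (`closes : E6ResidualTransport → PolarisedLiftingRank5 →
SectorComplement → Langlands`). The crux: every `ρ̄ : Γ_ℚ → SO₅(𝔽₃)` with the seven E₆-type
clauses (orthogonal of determinant one; surjective; spinor parity `= ε̄`; `tr ρ̄(c) = 1`;
unramified at `2` with Frobenius polynomial `≠ (X-1)³(X²+1)`; inertia at `3` acting through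
`{1, t}`, `t² = 1`, `tr t = 1`, non-trivially; and LIFTABLE through `PGSp₄(𝔽₃) ≅ SO₅(𝔽₃)`) is
residually automorphic of REGULAR weight over `K = ℚ(ζ₃)` from a cuspidal `π` on `GL₅(𝔸_K)`
(`q²`-normalised Hecke polynomials reduce to the characteristic polynomials of `ρ̄|Γ_K` at
geometric Frobenius).

This file concludes the crux BY NAME from three named stubs, cut exactly along the route's own
two-layer plan ("E6ResidualTransport ⇐ TateLiftE6 → ResidualFromBCGP → the congruence
bookkeeping", route header § TWO-LAYER PLAN), with the last step placed at cyclic base change: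

* `stub_tateLift` (finite group theory + local Galois bookkeeping; size M; TRUE in substance —
  the dictionary was machine-checked on the finite model, see below): from the seven clauses,
  SOME `GSp₄(𝔽₃)`-valued lift `ρ̃ : Γ_ℚ → GSp₄(𝔽₃)` (the clause-(vii) lift corrected by the
  quadratic character of `2`-power conductor that kills `ρ̃(I₂) ⊂ {±1}`) is BCGP-ADMISSIBLE
  (`BCGPShape`: `gᵀJg = ν(g)J`; surjective — forced, since `Sp₄(𝔽₃)` is a non-split double
  cover of `PSp₄(𝔽₃)`; `ν = ε̄`, i.e. `σ` fixes `ζ₃` iff `ν(ρ̃ σ) = 1` — the identity "similitude =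
  spinor norm" through `∧²₀`; `ν(c) = -1`; unramified at `2` with `charpoly ρ̃(Frob₂) ∉
  {(X²+X-1)², (X²-X-1)²} = {(x² ± x + 2)²}` — BCGP Thm 420's reading of "not of class 4C/12C";
  inertia at `3` through `{1, t̃}`, `t̃² = 1`, `ν(t̃) = -1`, non-trivially — whence
  `ρ̃|G_ℚ₃ ≅ ε̄U ⊕ U^*`, split ordinary and (dual) finite flat, BCGP Lemma 413) AND satisfies the
  DICTIONARY `(X - 1)·charpoly(ρ̄(σ)⁻¹) = charpoly(ν⁻¹ ∧² ρ̃(σ)⁻¹)` for every `σ` (second compound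
  matrix `compound₂`, similitude `simil`): `ν⁻¹∧²ρ̃` fixes the bivector `J⁻¹`, is special
  orthogonal for the wedge pairing, and on `(J⁻¹)^⊥` it is an `SO₅(𝔽₃)`-valued representation
  with the same kernel as `ρ̄`, hence conjugate to `ρ̄` because `Aut SO₅(𝔽₃) = Inn`
  (`SO₅(3) ≅ W(E₆) ≅ PSp₄(3).2` is complete). Finite-model checks run in this seat
  (`compute/gsp4check.py`, pure python, 18 s): `|GSp₄(𝔽₃)| = 103680`; for all `g`,
  `ν⁻¹C₂(g)` fixes `J⁻¹`, preserves the wedge form, has determinant `1`, `(X-1) ∣ charpoly`;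
  `|{ν⁻¹C₂(g)}| = 51840`, `= 25920` on `ν = 1`; `{g : charpoly of the SO₅-part = (X-1)³(X²+1)} =
  {g : charpoly g ∈ {(x²±x-1)²}}` (9720 elements, all with `ν = -1`); lifts of trace-`1`
  involutions: `1080` with `ν = -1, g² = 1` and `540` with `ν = 1, g² = -1`;
  `t̃ = diag(-1,-1,1,1)` has `ν = -1` and `SO₅`-part of trace `1`.
* `stub_residualAutomorphyGSp4` (THE HARDEST STUB, the unvendored chain; size L): every
  BCGP-admissible `ρ̃` has `ν⁻¹∧²₀ρ̃` residually automorphic of regular weight OVER ℚ: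
  BCGP2025 Lemma 416 (switching: `B = Jac(X)/ℚ`, `B[3] ≅ ρ̃`, good ordinary at `3`, `ρ̄_{B,2}`
  onto `S₅(b)`) + their 2-adic modularity theorem (`B` modular, weight 2) + Hida family through
  the ordinary weight-2 point (Pilloni2012) to a cohomological weight `k₁ > k₂ ≥ 3` + transfer
  `GSp₄ → GL₄` (GeeTaibi2019) + Kim's `∧²` (`∧²Π₄ = ν ⊞ Π₅`, `Π₅` cuspidal regular algebraic
  because `∧²₀ρ̃` is absolutely irreducible with image `SO₅(𝔽₃)` and the weights
  `{-(k₁-1), -(k₂-2), 0, k₂-2, k₁-1}` are distinct) + the Galois representation of `Π₅` in the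
  Clozel–Harris–Taylor normalisation (`r(Π₅) = std(ρ_g) ⊗ ε^{-2}`, geometric Frobenius
  eigenvalues `p²α_j`, and `ε̄² = 1` mod `3`, which is why the crux's `q²`-normalisation needs
  no twist). Stated purely on `GSp₄(𝔽₃)`-valued representations (no `ρ̄`, no `E₆`), with the
  congruence in the form `(X - 1)·θ(P₀) = j(charpoly(ν⁻¹∧²ρ̃(σ)⁻¹))` at arithmetic Frobenius `σ`.
* `stub_cyclicBaseChange` (Arthur–Clozel for the QUADRATIC extension `K/ℚ` on `GL₅`; size M;
  TRUE in substance): regular-algebraic residual automorphy over `ℚ` in the crux's format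
  transports to `K = ℚ(ζ₃)`: `BC(Π)` is cuspidal with NO image hypothesis because `5` is odd
  (`Π ≅ Π ⊗ η ⇒ 2 ∣ 5`, Arthur–Clozel Thm 4.2 (b)), regular algebraic, with Satake parameters
  `α` at split and `α²` at inert places (strong lifting, unramified places), so the new `P₀` has
  roots the `f`-th powers of the old ones (coefficients still in `𝒪`) and reduces to the
  characteristic polynomial of `ρ̄|Γ_K` at geometric Frobenius (`= ρ̄(Frob_p)^{-f}` at the
  almost all `p` where `ρ̄` — finite image — is unramified).

`E6ResidualTransport_of` is the composition: take the lift of `stub_tateLift`, the `Π/ℚ` of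
`stub_residualAutomorphyGSp4`, convert the `(X-1)`-multiplied compound congruence into the
`SO₅` congruence with the dictionary and cancellation of the monic factor `X - 1` in `k[X]`
(inside `∀ᶠ v in cofinite`), and base-change with `stub_cyclicBaseChange`. No stub alone gives
the crux or the summit (BC3 probes `bc/probe_*.lean`: all six FAIL), and the three interfaces are
typed in existing carriers only (`FramedGaloisRep`, `CuspidalAutomorphicRepData`,
`HasSatakeParamAt`, `IsRegularAlgebraic`, `IsArithFrobAt`).

Disproof used: none exists yet for this crux (`ledger crux ls stmt-Langlands-14222`: no
workfiles before this one); negatives index of the summit (K3KugaSatakeDescent) not touched.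
-/

noncomputable section

set_option linter.dupNamespace false

namespace Summit.Langlands.Langlands.Cruxes.E6ResidualTransport.Birth

open scoped Matrix Polynomial NumberField
open Filter Polynomial NumberField IsDedekindDomain Field
open Literature.NumberTheory.GaloisRepresentations Literature.NumberTheory.Automorphic
open Summit.Langlands.Langlands.Theses.OccultE6Transport (E6ResidualTransport)

/-! ## The finite dictionary `PGSp₄(𝔽₃) ≅ SO₅(𝔽₃)` in coordinates -/

/-- The crux's symplectic Gram matrix `J` (clause (vii)). -/
def J : Matrix (Fin 4) (Fin 4) (ZMod 3) := !![0, 0, 1, 0; 0, 0, 0, 1; -1, 0, 0, 0; 0, -1, 0, 0]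

/-- The similitude factor of `g`, read off the entry `(0,2)` of `gᵀ J g` (`J 0 2 = 1`). -/
def simil (g : Matrix (Fin 4) (Fin 4) (ZMod 3)) : ZMod 3 := (gᵀ * J * g) 0 2

/-- First index of the `a`-th pair `(i,j)`, `i < j`, in the order `01,02,03,12,13,23`. -/
def pr₁ : Fin 6 → Fin 4 := ![0, 0, 0, 1, 1, 2]

/-- Second index of the `a`-th pair. -/
def pr₂ : Fin 6 → Fin 4 := ![1, 2, 3, 2, 3, 3]

/-- The second compound matrix of `g`: the matrix of `∧² g` on the basis `e_i ∧ e_j` (`i < j`),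
entry `(ij),(kl)` = the minor `g_ik g_jl - g_il g_jk`. -/
def compound₂ (g : Matrix (Fin 4) (Fin 4) (ZMod 3)) : Matrix (Fin 6) (Fin 6) (ZMod 3) :=
  Matrix.of fun a b ↦ g (pr₁ a) (pr₁ b) * g (pr₂ a) (pr₂ b) - g (pr₁ a) (pr₂ b) * g (pr₂ a) (pr₁ b)

/-! ## The four interfaces -/

/-- The seven E₆-type clauses of the crux on `ρ̄ : Γ_ℚ → GL₅(𝔽₃)`, VERBATIM. -/
def E6Hyp (ρ : FramedGaloisRep ℚ (ZMod 3) 5) : Prop :=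
  (∀ σ, (ρ σ).valᵀ * (ρ σ).val = 1 ∧ (ρ σ).val.det = 1) ∧ (∀ g : Matrix (Fin 5) (Fin 5) (ZMod 3), gᵀ * g = 1 → g.det = 1 → ∃ σ, (ρ σ).val = g) ∧ (∀ (σ : absoluteGaloisGroup ℚ) (ζ : AlgebraicClosure ℚ), ζ ^ 2 + ζ + 1 = 0 → (σ • ζ = ζ ↔ ρ σ ∈ Subgroup.closure ((fun x : GL (Fin 5) (ZMod 3) ↦ x * x) '' {x : GL (Fin 5) (ZMod 3) | x.valᵀ * x.val = 1}))) ∧ (∀ (φ : ℚ →+* ℝ) (c : absoluteGaloisGroup ℚ), IsComplexConjugation φ c → (ρ c).val.trace = 1) ∧ (∀ v : HeightOneSpectrum (𝓞 ℚ), (2 : 𝓞 ℚ) ∈ v.asIdeal → ρ.IsUnramifiedAt v ∧ ∀ P, ρ.HasFrobCharpolyAt v P → P ≠ (X - 1) ^ 3 * (X ^ 2 + 1)) ∧ (∀ v : HeightOneSpectrum (𝓞 ℚ), (3 : 𝓞 ℚ) ∈ v.asIdeal → ∀ 𝔓 ∈ v.primesAbove, ∃ t : Matrix (Fin 5) (Fin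 5) (ZMod 3), t * t = 1 ∧ t.trace = 1 ∧ (∀ σ ∈ 𝔓.inertia (absoluteGaloisGroup ℚ), (ρ σ).val = 1 ∨ (ρ σ).val = t) ∧ (∃ σ ∈ 𝔓.inertia (absoluteGaloisGroup ℚ), (ρ σ).val = t)) ∧ (∃ ρt : FramedGaloisRep ℚ (ZMod 3) 4, (∀ σ, (∃ ν : ZMod 3, ν ≠ 0 ∧ (ρt σ).valᵀ * !![0, 0, 1, 0; 0, 0, 0, 1; -1, 0, 0, 0; 0, -1, 0, 0] * (ρt σ).val = ν • !![0, 0, 1, 0; 0, 0, 0, 1; -1, 0, 0, 0; 0, -1, 0, 0])) ∧ ∀ σ, (ρ σ = 1 ↔ ∃ c : ZMod 3, (ρt σ).val = c • (1 : Matrix (Fin 4) (Fin 4) (ZMod 3))))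

/-- BCGP-admissible `GSp₄(𝔽₃)`-valued residual representation (BCGP2025 Lemma 416 / Thm 420
hypotheses, plus surjectivity): (a) `gᵀJg = ν(g)J`; (b) onto `GSp₄(𝔽₃)`; (c) `ν = ε̄`
(`σ` fixes a primitive cube root of unity iff `ν(ρ̃ σ) = 1`); (d) odd: `ν(c) = -1`;
(e) unramified at `2`, `charpoly ρ̃(Frob₂) ∉ {(X²+X-1)², (X²-X-1)²}` (= `(x² ± x + 2)²`, "not
4C/12C"); (f) inertia at `3` acts through `{1, t̃}` non-trivially, `t̃² = 1`, `ν(t̃) = -1`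
(⇒ `ρ̃|G_ℚ₃ ≅ ε̄U ⊕ U^*`: split ordinary, dual finite flat). -/
def BCGPShape (ρt : FramedGaloisRep ℚ (ZMod 3) 4) : Prop :=
  (∀ σ, (ρt σ).valᵀ * J * (ρt σ).val = simil (ρt σ).val • J) ∧
  (∀ g : Matrix (Fin 4) (Fin 4) (ZMod 3), gᵀ * J * g = simil g • J → simil g ≠ 0 → ∃ σ, (ρt σ).val = g) ∧
  (∀ (σ : absoluteGaloisGroup ℚ) (ζ : AlgebraicClosure ℚ), ζ ^ 2 + ζ + 1 = 0 → (σ • ζ = ζ ↔ simil (ρt σ).val = 1)) ∧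
  (∀ (φ : ℚ →+* ℝ) (c : absoluteGaloisGroup ℚ), IsComplexConjugation φ c → simil (ρt c).val = -1) ∧
  (∀ v : HeightOneSpectrum (𝓞 ℚ), (2 : 𝓞 ℚ) ∈ v.asIdeal → ρt.IsUnramifiedAt v ∧ ∀ P, ρt.HasFrobCharpolyAt v P → P ≠ (X ^ 2 + X - 1) ^ 2 ∧ P ≠ (X ^ 2 - X - 1) ^ 2) ∧
  (∀ v : HeightOneSpectrum (𝓞 ℚ), (3 : 𝓞 ℚ) ∈ v.asIdeal → ∀ 𝔓 ∈ v.primesAbove, ∃ t : Matrix (Fin 4) (Fin 4) (ZMod 3), t * t = 1 ∧ simil t = -1 ∧ (∀ σ ∈ 𝔓.inertia (absoluteGaloisGroup ℚ), (ρt σ).val = 1 ∨ (ρt σ).val = t) ∧ (∃ σ ∈ 𝔓.inertia (absoluteGaloisGroup ℚ), (ρt σ).val = t))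

/-- The dictionary `ρ̄ ≅ ν⁻¹ ∧²₀ ρ̃` at the level of characteristic polynomials (at `σ⁻¹`, i.e.
geometric Frobenius when `σ` is arithmetic): `(X - 1)·charpoly(ρ̄(σ)⁻¹) = charpoly(ν⁻¹ C₂(ρ̃(σ)⁻¹))`. -/
def Dictionary (ρ : FramedGaloisRep ℚ (ZMod 3) 5) (ρt : FramedGaloisRep ℚ (ZMod 3) 4) : Prop :=
  ∀ σ : absoluteGaloisGroup ℚ,
    (X - C 1) * (ρ σ)⁻¹.val.charpoly = ((simil (ρt σ)⁻¹.val)⁻¹ • compound₂ (ρt σ)⁻¹.val).charpoly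

/-- Regular-algebraic residual automorphy OVER ℚ of `ν⁻¹∧²₀ρ̃`, in the crux's format with the
harmless factor `X - 1` kept on the automorphic side: a regular algebraic cuspidal `π` on
`GL₅(𝔸_ℚ)`, `𝒪 ⊂ ℂ` holding the `p²`-normalised Hecke polynomials a.e., `θ : 𝒪 → k ⊇ 𝔽₃` with
`(X - 1)·θ(P₀) = j(charpoly(ν⁻¹ C₂(ρ̃(σ)⁻¹)))` at every arithmetic Frobenius `σ`. -/
def ResAutQCompound (ρt : FramedGaloisRep ℚ (ZMod 3) 4) : Prop :=
  ∀ hcpt : isCompact_glFiniteIntegralLevel 5 ℚ, ∃ (π : CuspidalAutomorphicRepData 5 ℚ hcpt) (k : Type) (_ : Field k) (j : ZMod 3 →+* k) (𝒪 : Subring ℂ) (θ : 𝒪 →+* k), π.1.IsRegularAlgebraic ∧ ∀ᶠ v : HeightOneSpectrum (𝓞 ℚ) in cofinite, ∃ (α : Multiset ℂ) (P₀ : Polynomial 𝒪), π.1.HasSatakeParamAt v α ∧ P₀.map 𝒪.subtype = (α.map fun a ↦ X - C ((v.residueCard : ℂ) ^ 2 * a)).prod ∧ ∀ 𝔓 ∈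 v.primesAbove, ∀ σ : absoluteGaloisGroup ℚ, IsArithFrobAt (𝓞 ℚ) σ 𝔓 → (X - C 1) * P₀.map θ = (((simil (ρt σ)⁻¹.val)⁻¹ • compound₂ (ρt σ)⁻¹.val).charpoly).map j

/-- Regular-algebraic residual automorphy OVER ℚ of `ρ̄` itself: the crux's conclusion with `ℚ` in
place of `K` (congruence at geometric Frobenius, `p²`-normalised Hecke polynomials). -/
def ResAutQ (ρ : FramedGaloisRep ℚ (ZMod 3) 5) : Prop :=
  ∀ hcpt : isCompact_glFiniteIntegralLevel 5 ℚ, ∃ (π : CuspidalAutomorphicRepData 5 ℚ hcpt) (k : Type) (_ : Field k) (j : ZMod 3 →+* k) (𝒪 : Subring ℂ) (θ : 𝒪 →+* k), π.1.IsRegularAlgebraic ∧ ∀ᶠ v : HeightOneSpectrum (𝓞 ℚ) in cofinite, ∃ (α : Multiset ℂ) (P₀ : Polynomial 𝒪), π.1.HasSatakeParamAt v α ∧ P₀.map 𝒪.subtype = (α.map fun a ↦ X - C ((v.residueCard : ℂ) ^ 2 * a)).prod ∧ ∀ 𝔓 ∈ v.primesAbove, ∀ σ : absoluteGaloisGroup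 ℚ, IsArithFrobAt (𝓞 ℚ) σ 𝔓 → (ρ σ)⁻¹.val.charpoly.map j = P₀.map θ

/-- The crux's conclusion (regular-algebraic residual automorphy over `K = ℚ(ζ₃)`), VERBATIM. -/
def ResAutK (ρ : FramedGaloisRep ℚ (ZMod 3) 5) : Prop :=
  (∀ hcpt : isCompact_glFiniteIntegralLevel 5 (CyclotomicField 3 ℚ), ∃ (π : CuspidalAutomorphicRepData 5 (CyclotomicField 3 ℚ) hcpt) (k : Type) (_ : Field k) (j : ZMod 3 →+* k) (𝒪 : Subring ℂ) (θ : 𝒪 →+* k), π.1.IsRegularAlgebraic ∧ ∀ᶠ v : HeightOneSpectrum (𝓞 (CyclotomicField 3 ℚ)) in cofinite, ∃ (α : Multiset ℂ) (P₀ : Polynomial 𝒪), π.1.HasSatakeParamAt v α ∧ P₀.map 𝒪.subtype = (α.map fun a ↦ X - C ((v.residueCard : ℂ) ^ 2 * a)).prod ∧ ∀ 𝔓 ∈ v.primesAbove, ∀ σ : absoluteGaloisGroup (CyclotomicField 3 ℚ), IsArithFrobAt (𝓞 (CyclotomicField 3 ℚ)) σ 𝔓 → (ρ.restrictField (CyclotomicField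 3 ℚ) σ)⁻¹.val.charpoly.map j = P₀.map θ)

/-- Read-back: the crux is literally `∀ ρ̄, E6Hyp ρ̄ → ResAutK ρ̄`. -/
theorem crux_iff : E6ResidualTransport ↔ ∀ ρ : FramedGaloisRep ℚ (ZMod 3) 5, E6Hyp ρ → ResAutK ρ :=
  Iff.rfl

/-! ## The three stubs -/

/-- **Stub 1 (TateLiftE6; finite group theory, size M).** An E₆-type `ρ̄` has a BCGP-admissible
`GSp₄(𝔽₃)`-lift satisfying the charpoly dictionary. Why plausibly true: see the module docstring
(clause (vii) + twist by a `2`-power-conductor quadratic character; `Aut SO₅(𝔽₃) = Inn`;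
`Sp₄(𝔽₃) → PSp₄(𝔽₃)` non-split; finite-model checks of `ν = ε̄`, the Frobenius-at-`2` classes and
the trace-`1` involutions). Sources: BCGP2025 (arXiv:2502.20645) Lemma 416/Thm 420 p.135–136,
Hunt1996, Wilson 2009 §3.12.4; refuter evidence e6check.log on stmt-Langlands-14222. -/
theorem stub_tateLift : ∀ ρ : FramedGaloisRep ℚ (ZMod 3) 5, E6Hyp ρ →
    ∃ ρt : FramedGaloisRep ℚ (ZMod 3) 4, BCGPShape ρt ∧ Dictionary ρ ρt := by
  sorry

/-- **Stub 2 (ResidualFromBCGP over ℚ; the hardest stub, size L).** Every BCGP-admissible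
`ρ̃ : Γ_ℚ → GSp₄(𝔽₃)` has `ν⁻¹∧²₀ρ̃` residually automorphic of regular weight over `ℚ` from a
cuspidal `π` on `GL₅(𝔸_ℚ)`. Chain: BCGP2025 Lemma 416 + 2-adic modularity (weight 2) → Hida
family to cohomological weight (Pilloni2012) → `GSp₄ → GL₄` (GeeTaibi2019) → Kim2003 `∧²` and
cuspidality of `Π₅` (AsgariRaghuram) → CHT-normalised Galois representation of `Π₅`
(ClozelHarrisTaylor2008, ChenevierHarris2013); `ε̄² = 1`. Why it might fail: five unvendored
theorems and a weight passage `(2,2) →` regular through the Hida family at `p = 3 ∣ #im ρ̃`. -/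
theorem stub_residualAutomorphyGSp4 : ∀ ρt : FramedGaloisRep ℚ (ZMod 3) 4, BCGPShape ρt →
    ResAutQCompound ρt := by
  sorry

/-- **Stub 3 (cyclic base change `ℚ(ζ₃)/ℚ` on `GL₅` with the congruence bookkeeping; size M).**
Arthur–Clozel 1989 Ch. 3 Thm 4.2 (a),(b) and Thm 5.1 (`[K:ℚ] = 2 ∤ 5`: the base change of a
cuspidal `Π` is cuspidal, regular algebraic, with Satake parameters `α^{f_w}`), plus
`restrictField`/Frobenius bookkeeping (`Frob_w = Frob_p^{f_w}` modulo inertia at the almost all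
`p` where the finite-image `ρ̄` is unramified); `P₀ ↦` the polynomial of `f_w`-th powers of its
roots, coefficients still in `𝒪`. Tree: `ArthurClozel1989_weakLifting_cuspidal`,
`ArthurClozel1989_dvd_of_twist_eq`, `ArthurClozel1989_strongLifting_unramified` (other carrier). -/
theorem stub_cyclicBaseChange : ∀ ρ : FramedGaloisRep ℚ (ZMod 3) 5, ResAutQ ρ → ResAutK ρ := by
  sorry

/-! ## Stub statements as named propositions (for the BC3 probes and the registrar) -/

namespace _Goal

/-- Statement of `stub_tateLift`. -/
def stub_tateLift : Prop :=
  ∀ ρ : FramedGaloisRep ℚ (ZMod 3) 5, E6Hyp ρ → ∃ ρt : FramedGaloisRep ℚ (ZMod 3) 4, BCGPShape ρt ∧ Dictionary ρ ρt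

/-- Statement of `stub_residualAutomorphyGSp4`. -/
def stub_residualAutomorphyGSp4 : Prop :=
  ∀ ρt : FramedGaloisRep ℚ (ZMod 3) 4, BCGPShape ρt → ResAutQCompound ρt

/-- Statement of `stub_cyclicBaseChange`. -/
def stub_cyclicBaseChange : Prop :=
  ∀ ρ : FramedGaloisRep ℚ (ZMod 3) 5, ResAutQ ρ → ResAutK ρ

end _Goal

/-- The stubs prove their named statements (read-back). -/
theorem goals_hold : _Goal.stub_tateLift ∧ _Goal.stub_residualAutomorphyGSp4 ∧ _Goal.stub_cyclicBaseChange :=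
  ⟨stub_tateLift, stub_residualAutomorphyGSp4, stub_cyclicBaseChange⟩

/-! ## The composition: the three stubs imply the crux BY NAME -/

/-- From the `(X - 1)`-multiplied compound congruence and the dictionary to the `SO₅` congruence:
cancel the monic factor `X - 1` in `k[X]`. -/
theorem congr_of_compound {k : Type} [Field k] (j : ZMod 3 →+* k) {𝒪 : Subring ℂ} (θ : 𝒪 →+* k)
    (P₀ : Polynomial 𝒪) (Q : Polynomial (ZMod 3)) (R : Polynomial (ZMod 3))
    (hd : (X - C 1) * Q = R) (hF : (X - C 1) * P₀.map θ = R.map j) :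
    Q.map j = P₀.map θ := by
  have h : (X - C 1) * Q.map j = (X - C 1) * P₀.map θ := by
    rw [hF, ← hd, Polynomial.map_mul, Polynomial.map_sub, Polynomial.map_X, Polynomial.map_C,
      map_one j]
  exact mul_left_cancel₀ (X_sub_C_ne_zero 1) h

/-- **BC3 composition.** `stub_tateLift → stub_residualAutomorphyGSp4 → stub_cyclicBaseChange →
E6ResidualTransport` (the route decl, by name). -/
theorem E6ResidualTransport_of (h₁ : _Goal.stub_tateLift) (h₂ : _Goal.stub_residualAutomorphyGSp4)
    (h₃ : _Goal.stub_cyclicBaseChange) : E6ResidualTransport := by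
  intro ρ h
  obtain ⟨ρt, hshape, hdict⟩ := h₁ ρ h
  refine h₃ ρ ?_
  intro hcpt
  obtain ⟨π, k, instk, j, 𝒪, θ, hreg, hae⟩ := h₂ ρt hshape hcpt
  refine ⟨π, k, instk, j, 𝒪, θ, hreg, hae.mono ?_⟩
  rintro v ⟨α, P₀, hα, hP, hF⟩
  exact ⟨α, P₀, hα, hP, fun 𝔓 h𝔓 σ hσ ↦
    congr_of_compound j θ P₀ _ _ (hdict σ) (hF 𝔓 h𝔓 σ hσ)⟩

end Summit.Langlands.Langlands.Cruxes.E6ResidualTransport.Birth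

end
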